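import Literature.Computability.AlgebraicComplexity.IK2020TableauLiftingRightPart
import Literature.Computability.AlgebraicComplexity.PowerSumProductMultiplicityObstruction
import Literature.Computability.AlgebraicComplexity.IK2020ShiftLemmaProofs
import HarnessLib

/-!
# Ikenmeyer–Kandasamy 2020, §13: the highest-weight vector of a lifted tableau and its value
# on `GL_m · p` as a sum of `γ`-products (brick B2 of the `IK2020_thm_4_2` edge)

Typed-and-proved literature (cell `val-lit`, row IK20-A; honest framing: bookkeeping of
Ikenmeyer–Kandasamy's toy model `p = x₁^D + ⋯ + x_m^D`; VP ≠ VNP is NOT proved and nothing here is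
progress on it). Source: C. Ikenmeyer, U. Kandasamy, STOC 2020 = arXiv:1911.03990
[IkenmeyerKandasamy2019], Thm. 11.1 (TeX L940–952, "the function `A ↦ γ(A M_{δ,m} T)` is a highest
weight vector of weight `ν^*` … `γ(A M_{δ,m} T) = ∑_{φ ∈ ℳ_{δ,m}} γ(A φT)`") and the proof of the Main
Technical Theorem 4.2 in §13 (TeX L1185–1206: "`f̄^{S_{ϱ,i}}(gp) = … γ(g M_{m,d} T_{ϱ,i}) =
∑_{φ ∈ ℳ_{m,d}} γ(g φ T_{ϱ,i})`", the lifted tableau `T_{ϱ,i} = leftpart + rightpart` of the Tableau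
Lifting Theorem 13.1).

## What is proved (theorem-only; no definitions, no named facts)

For a tableau `T` over the alphabet `Fin δ` in the column format `IK2020.ColTableau` of
`IK20HighestWeightVectors.lean`, with column heights `≤ m` and EVERY LABEL OCCURRING EXACTLY `D`
TIMES, there is a polynomial function `F_T` on `Sym^D ℂ^m` (an element of the tree's coordinate ring
`MvPolynomial (DegIdx (Fin m) D) ℂ`, namely the tableau polynomial `TableauEval.TabM.tabPoly` of the
tableau datum built from `T`) such that

* `F_T ∈ highestWeightSpace (coordRep (Fin m) ℂ D) ν^*`, `ν` the shape of `T` — IK Thm. 11.1, last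
  assertion = the tree's `TabM.tabPoly_mem_highestWeightSpace` (`TableauHighestWeight.lean`); the
  weight is written `j ↦ -#{c | rev j < h c}` (the dual weight of the row lengths), and for a lifted
  tableau of shape `λ + (m × E)` it is `Weight.dualOfPartition m (addRect λ m E)`
  (`IK2020.exists_hwv_liftedTableau`);
* for every matrix `A`, `F_T(A · p) = (D!)^δ · ∑_{φ : Fin δ → Fin m} γ(A' (φT))` with
  `γ = IK2020.gammaProd` (eq. (8.2)) and `A' = (A_{rev a, b})_{a,b}` the matrix `A` with its ROWS
  REVERSED — IK Thm. 11.1's formula = the tree's `TabM.EC_powers` /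
  `IK2020.aeval_linSubst_psum_tabPoly` (`PowerSumWaringRankEquation.lean`,
  `PowerSumProductMultiplicityObstruction.lean`). The row reversal is forced by the tree's
  conventions: highest weight vectors are taken for the UPPER triangular Borel of `GL_m` in the
  contragredient action, so the column alternators sit on the antitone enumeration
  `x_i = m - 1 - i` of the variables, and `det (A_{x_i, φ(T(c,r))})_{i,r} = colTopDet A' (φ ∘ T(c,·))`.
  (`det A' = sign(rev) · det A`, `IK2020.det_revRows`; for the assembly of Thm. 4.2 points `A'` of
  determinant `±1` are as good as points of `SL_m`.)

For the PAIR `(L, R)` produced by `IK2020_thm_13_1` (left part `rectTableau L`, `E` columns of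
height `m`; right part `⟨S.C, S.h, R⟩` of the shape of `S`; `count_L u + count_R u = D`) the value is
`(D!)^δ ∑_φ γ(A' (φL)) · γ(A' (φR))` (`IK2020.exists_hwv_eval_eq_sum_gammaProd_pair`) — exactly the
left-hand side of the §13 identity `IK2020.stab_card_mul_sum_gammaProd_lift_eq` (brick B1,
`IK2020Thm42LiftIdentity.lean`, val-lit-p4), so that B1 ∘ B2 give, on `det A' = 1`,
`F_T(A · p) = c · ∑_{π ∈ 𝔖_m} γ(A' (πS))` with `c ≠ 0` (TeX L1192–1206).

`SL_m`-READY FORM (§4, for the assembly): B1 needs the `γ`-side at a matrix of determinant `1`,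
while `F(s · p)` sees `w₀ s` (`det = sign(w₀) det s`). By homogeneity of `γ` (`gammaProd_smul`) one
rescales: with `ζ^m = sign(w₀)` (`exists_root_sign_rev`), `β(s) := ζ⁻¹ w₀ s` is a bijection of `SL_m`
(`exists_slEquiv_revScale`) and `F(s · p) = c · ∑_φ γ(β s, φL) γ(β s, φR)`, `c ≠ 0`, for all `s`
(`exists_hwv_liftedTableau_revScale`); linear independence of the orbit functions of
`IK2020_thm_9_1_orbitFunctions` survives composition with `β` (`linearIndependent_comp_right_of_surjective`).
This is IK's sentence "homogeneous of the same degree … restrictions to `SL_m p`" (TeX L1153–1154)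
in the tree's Borel convention.

Internals: the box enumeration `Fin δ × Fin D ≃ boxes` of a tableau with all counts `D`
(`exists_boxEquiv_of_count_eq`, from `ColTableau.card_filter_box_eq_count`), the concatenation
`leftpart + rightpart` as one `ColTableau` (`Fin.append` / `Fin.addCases`, `Fin.prod_univ_add`).

## References

* [IkenmeyerKandasamy2019] C. Ikenmeyer, U. Kandasamy, Proc. 52nd ACM STOC (2020) 713–726 =
  arXiv:1911.03990: Thm. 11.1 (L940–952), §13 proof of Thm. 4.2 (L1185–1206), Lemma 8.1 / eq. (8.2).
* [DorflerIkenmeyerPanova2020] J. Dörfler, C. Ikenmeyer, G. Panova, SIAM J. Appl. Algebra Geom. 4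
  (2020), §5 (tableau polynomials as highest-weight vectors).

## Mathlib and tree

Tree: `TableauEval.TabM`, `TabM.Frame`, `TabM.tabPoly`, `TabM.tabPoly_mem_highestWeightSpace`,
`IsAntitoneEnum`, `IK2020.aeval_linSubst_psum_tabPoly`, `IK2020.colTopDet`, `IK2020.gammaProd`,
`IK2020.ColTableau.card_filter_box_eq_count`, `IK2020.ofPartition_addRect`, `Weight.dualOfPartition`.
Mathlib: `Equiv.sigmaFiberEquiv`, `Fintype.equivFinOfCardEq`, `Fin.append`, `Fin.addCases`,
`Fin.prod_univ_add`, `Matrix.det_permute`, `Matrix.det_smul`, `IsAlgClosed.exists_pow_nat_eq`,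
`LinearMap.funLeft`, `LinearIndependent.map'`.
-/

noncomputable section

open scoped BigOperators

namespace Literature.Computability.AlgebraicComplexity

namespace IK2020

open TableauEval MvPolynomial Finset
open _root_.Literature.NumberTheory.DiophantineGeometry

/-! ### §1 Plumbing: box enumeration, casts along equal column heights, reversed rows -/

/-- A tableau over `Fin δ` in which every label occurs exactly `D` times has a box enumeration
`Fin δ × Fin D ≃ boxes` sending `(u, s)` to a box labelled `u` (the `box` of a `TabM`, Thm. 11.1's
"tableau `T` in which every entry appears exactly `D` many times").
[cite: IkenmeyerKandasamy2019, Thm. 11.1 (proof)] -/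
theorem exists_boxEquiv_of_count_eq {δ D : ℕ} (T : ColTableau (Fin δ))
    (hcount : ∀ u, T.count u = D) :
    ∃ e : Fin δ × Fin D ≃ (Σ c : Fin T.C, Fin (T.h c)), ∀ p, T.entry (e p).1 (e p).2 = p.1 := by
  classical
  let ent : (Σ c : Fin T.C, Fin (T.h c)) → Fin δ := fun b => T.entry b.1 b.2
  have hcard : ∀ u, Fintype.card {b // ent b = u} = D := by
    intro u
    rw [Fintype.card_subtype, ← hcount u, ← ColTableau.card_filter_box_eq_count]
  let f : (u : Fin δ) → {b // ent b = u} ≃ Fin D := fun u => Fintype.equivFinOfCardEq (hcard u)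
  refine ⟨(Equiv.sigmaEquivProd (Fin δ) (Fin D)).symm.trans
      ((Equiv.sigmaCongrRight f).symm.trans (Equiv.sigmaFiberEquiv ent)), fun p => ?_⟩
  exact ((f p.1).symm p.2).2

/-- Column determinants do not see a cast along equal heights. [cite: IkenmeyerKandasamy2019, Lemma 8.1] -/
private theorem colTopDet_comp_cast {k : Type*} [CommRing k] {m j j' : ℕ}
    (g : Matrix (Fin m) (Fin m) k) (e : j = j') (hj : j ≤ m) (hj' : j' ≤ m) (col : Fin j' → Fin m) :
    colTopDet k g hj (fun r => col (r.cast e)) = colTopDet k g hj' col := by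
  subst e
  rfl

/-- Counting along a cast. [folklore] -/
private theorem card_filter_comp_cast {j j' : ℕ} (e : j = j') (p : Fin j' → Prop)
    [DecidablePred p] :
    (univ.filter fun r : Fin j => p (r.cast e)).card = (univ.filter p).card := by
  subst e
  rfl

/-- The matrix with reversed rows `A' = (A_{rev a, b})` has determinant `sign(rev) · det A`
(so `det A' = ± det A`). [folklore] -/
private theorem det_revRows_aux {m : ℕ} (A : Matrix (Fin m) (Fin m) ℂ) :
    (Matrix.of fun a b => A (Fin.rev a) b).det = ((Equiv.Perm.sign (@Fin.revPerm m) : ℤ) : ℂ) * A.det := by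
  have h : (Matrix.of fun a b => A (Fin.rev a) b) = A.submatrix (⇑(@Fin.revPerm m)) id := by
    ext a b
    rfl
  rw [h, Matrix.det_permute]

/-- **Reversed rows and `SL_m`**: `det (A_{rev a, b})_{a,b} = sign(rev) · det A`; in particular the
row reversal maps matrices of determinant `sign(rev)` onto `SL_m` and preserves `{A | det A = ±1}`
(used by the assembly of Thm. 4.2 to pass between `A` and `A'`).
[cite: IkenmeyerKandasamy2019, Thm. 4.2 (proof, §13)] -/
theorem det_revRows {m : ℕ} (A : Matrix (Fin m) (Fin m) ℂ) :
    Matrix.det (fun a b => A (Fin.rev a) b) =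
      ((Equiv.Perm.sign (@Fin.revPerm m) : ℤ) : ℂ) * A.det :=
  det_revRows_aux A

/-! ### §2 One tableau with all counts `D`: the highest-weight vector and its value on `GL_m · p` -/

/-- **IK Thm. 11.1 for a tableau `T` over `Fin δ` with every label occurring exactly `D` times**
(column heights `≤ m`, `m ≥ 1`): there is `F_T ∈ ℂ[Sym^D ℂ^m]` which is a highest-weight vector of
weight `ν^*`, `ν` the shape of `T` (weight `j ↦ -#{c | rev j < h c}`), and whose value at
`A · p`, `p = x₁^D + ⋯ + x_m^D`, is `(D!)^δ ∑_{φ : Fin δ → Fin m} γ(A' (φT))`, `A' = (A_{rev a, b})`,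
`γ = gammaProd` (eq. (8.2)). `F_T` is the tableau polynomial of the datum built from `T` (alternators
on the antitone enumeration of the variables, boxes enumerated label by label).
[cite: IkenmeyerKandasamy2019, Thm. 11.1] -/
theorem exists_hwv_eval_eq_sum_gammaProd {m D δ : ℕ} (hm : 0 < m) (T : ColTableau (Fin δ))
    (hT : ∀ c, T.h c ≤ m) (hcount : ∀ u, T.count u = D) :
    ∃ F ∈ highestWeightSpace (coordRep (Fin m) ℂ D)
        (fun j : Fin m =>
          -((univ.filter fun c : Fin T.C => ((Fin.rev j : Fin m) : ℕ) < T.h c).card : ℤ)),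
      ∀ A : Matrix (Fin m) (Fin m) ℂ,
        aeval (formCoeff D (linSubst (Fin m) ℂ A (psum (Fin m) ℂ D))) F =
          (D.factorial : ℂ) ^ δ * ∑ φ : Fin δ → Fin m,
            gammaProd ℂ (fun a b => A (Fin.rev a) b) T.h hT fun c r => φ (T.entry c r) := by
  classical
  obtain ⟨e, he⟩ := exists_boxEquiv_of_count_eq T hcount
  -- the antitone enumeration `x i = m - 1 - i` of the variables `Fin m`
  obtain ⟨x, hx, hxv⟩ : ∃ x : ℕ → Fin m, IsAntitoneEnum x m ∧ ∀ n, (x n : ℕ) = m - 1 - n := by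
    refine ⟨fun n => ⟨m - 1 - n, by omega⟩, ⟨fun i j hij hj => ?_, fun v => ?_⟩, fun n => rfl⟩
    · rw [Fin.lt_def]
      dsimp only
      omega
    · refine ⟨m - 1 - v, by omega, Fin.ext ?_⟩
      dsimp only
      have := v.2
      omega
  -- the tableau datum of `T` and its frame
  let Fr : (⟨T.C, δ, D, T.h, fun _ i => x i, fun u s => e (u, s)⟩ : TabM (Fin m)).Frame :=
    ⟨e, fun u s => rfl⟩
  refine ⟨(⟨T.C, δ, D, T.h, fun _ i => x i, fun u s => e (u, s)⟩ : TabM (Fin m)).tabPoly ℂ, ?_, ?_⟩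
  · refine TabM.tabPoly_mem_highestWeightSpace _ Fr hx hT (fun c r => rfl) _ fun i hi => ?_
    have hrev : ((Fin.rev (x i) : Fin m) : ℕ) = i := by
      rw [Fin.val_rev, hxv]
      omega
    change -(((univ.filter fun c : Fin T.C => ((Fin.rev (x i) : Fin m) : ℕ) < T.h c).card : ℤ)) = _
    rw [hrev]
  · intro A
    refine (IK2020.aeval_linSubst_psum_tabPoly _ Fr A).trans ?_
    change (D.factorial : ℂ) ^ δ * _ = _
    congr 1
    refine sum_congr rfl fun φ _ => ?_
    unfold gammaProd
    refine prod_congr rfl fun c _ => ?_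
    unfold colTopDet
    congr 1
    ext i r
    simp only [Matrix.of_apply]
    have h1 : T.entry c r = (e.symm ⟨c, r⟩).1 := by
      have := he (e.symm ⟨c, r⟩)
      rw [Equiv.apply_symm_apply] at this
      exact this
    have h2 : x i = Fin.rev (Fin.castLE (hT c) i) := by
      apply Fin.ext
      rw [hxv, Fin.val_rev, Fin.val_castLE]
      omega
    change A (x i) (φ (e.symm ⟨c, r⟩).1) = A (Fin.rev (Fin.castLE (hT c) i)) (φ (T.entry c r))
    rw [← h1, h2]

/-! ### §3 The lifted tableau `leftpart + rightpart` of Thm. 13.1 -/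

/-- **The value splits over the two parts** (§13, TeX L1192–1197: "`γ(g M_{m,d} T) = ∑_φ γ(g φT)`"
with Cor. 8.3's factorisation `γ(g φT) = γ(g leftpart(φT)) · γ(g rightpart(φT))`): for the pair
`(L, R)` of `IK2020_thm_13_1` — `E` left columns of height `m` with labels `L c r`, a right part of
the shape of `S` with labels `R c r`, every label `u < δ` occurring `D` times in total — there is a
highest-weight vector `F ∈ ℂ[Sym^D ℂ^m]` of weight `j ↦ -(E + #{c | rev j < S.h c})` (the dual weight
of the shape `shape(S) + (m × E)`) with
`F(A · p) = (D!)^δ ∑_{φ : Fin δ → Fin m} γ(A' (φL)) · γ(A' (φR))`, `A' = (A_{rev a, b})`.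
[cite: IkenmeyerKandasamy2019, Thm. 4.2 (proof, §13) and Thm. 11.1] -/
theorem exists_hwv_eval_eq_sum_gammaProd_pair {m D E δ : ℕ} (hm : 0 < m)
    (S : ColTableau (Fin m)) (hS : ∀ c, S.h c ≤ m)
    (L : Fin E → Fin m → Fin δ) (R : (c : Fin S.C) → Fin (S.h c) → Fin δ)
    (hcount : ∀ u, (rectTableau L).count u + (ColTableau.mk S.C S.h R).count u = D) :
    ∃ F ∈ highestWeightSpace (coordRep (Fin m) ℂ D)
        (fun j : Fin m => -((E : ℤ) +
          ((univ.filter fun c : Fin S.C => ((Fin.rev j : Fin m) : ℕ) < S.h c).card : ℤ))),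
      ∀ A : Matrix (Fin m) (Fin m) ℂ,
        aeval (formCoeff D (linSubst (Fin m) ℂ A (psum (Fin m) ℂ D))) F =
          (D.factorial : ℂ) ^ δ * ∑ φ : Fin δ → Fin m,
            gammaProd ℂ (fun a b => A (Fin.rev a) b) (fun _ : Fin E => m) (fun _ => le_rfl)
                (fun c r => φ (L c r)) *
              gammaProd ℂ (fun a b => A (Fin.rev a) b) S.h hS (fun c r => φ (R c r)) := by
  classical
  -- the concatenated tableau: heights `Fin.append (m, …, m) S.h`, entries `L` then `R`
  obtain ⟨ent, hleft, hright⟩ :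
      ∃ ent : (c : Fin (E + S.C)) → Fin (Fin.append (fun _ : Fin E => m) S.h c) → Fin δ,
        (∀ i r, ent (Fin.castAdd S.C i) r =
            L i (r.cast (Fin.append_left (fun _ : Fin E => m) S.h i))) ∧
        (∀ j r, ent (Fin.natAdd E j) r =
            R j (r.cast (Fin.append_right (fun _ : Fin E => m) S.h j))) :=
    ⟨Fin.addCases (motive := fun c => Fin (Fin.append (fun _ : Fin E => m) S.h c) → Fin δ)
        (fun i r => L i (r.cast (Fin.append_left (fun _ : Fin E => m) S.h i)))
        (fun j r => R j (r.cast (Fin.append_right (fun _ : Fin E => m) S.h j))),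
      fun i r => by rw [Fin.addCases_left], fun j r => by rw [Fin.addCases_right]⟩
  have hTle : ∀ c : Fin (E + S.C), Fin.append (fun _ : Fin E => m) S.h c ≤ m := by
    intro c
    refine Fin.addCases (fun i => ?_) (fun j => ?_) c
    · rw [Fin.append_left]
    · rw [Fin.append_right]; exact hS j
  have hTcount : ∀ u,
      (⟨E + S.C, Fin.append (fun _ : Fin E => m) S.h, ent⟩ : ColTableau (Fin δ)).count u = D := by
    intro u
    rw [← hcount u]
    unfold ColTableau.count rectTableau
    dsimp only
    rw [Fin.sum_univ_add]
    congr 1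
    · refine sum_congr rfl fun i _ => ?_
      simp only [hleft]
      exact card_filter_comp_cast (Fin.append_left (fun _ : Fin E => m) S.h i) (fun r => L i r = u)
    · refine sum_congr rfl fun j _ => ?_
      simp only [hright]
      exact card_filter_comp_cast (Fin.append_right (fun _ : Fin E => m) S.h j) (fun r => R j r = u)
  -- the γ-product of the concatenation splits (Cor. 8.3)
  have hsplit : ∀ (g : Matrix (Fin m) (Fin m) ℂ) (φ : Fin δ → Fin m),
      gammaProd ℂ g (Fin.append (fun _ : Fin E => m) S.h) hTle (fun c r => φ (ent c r)) =
        gammaProd ℂ g (fun _ : Fin E => m) (fun _ => le_rfl) (fun c r => φ (L c r)) *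
          gammaProd ℂ g S.h hS (fun c r => φ (R c r)) := by
    intro g φ
    unfold gammaProd
    rw [Fin.prod_univ_add]
    congr 1
    · refine prod_congr rfl fun i _ => ?_
      simp only [hleft]
      exact colTopDet_comp_cast g (Fin.append_left (fun _ : Fin E => m) S.h i) _ _
        (fun r => φ (L i r))
    · refine prod_congr rfl fun j _ => ?_
      simp only [hright]
      exact colTopDet_comp_cast g (Fin.append_right (fun _ : Fin E => m) S.h j) _ _
        (fun r => φ (R j r))
  -- row lengths of the concatenation: `E + #{c | i < S.h c}` for `i < m`
  have hrow : ∀ i : ℕ, i < m →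
      (univ.filter fun c : Fin (E + S.C) => i < Fin.append (fun _ : Fin E => m) S.h c).card =
        E + (univ.filter fun c : Fin S.C => i < S.h c).card := by
    intro i hi
    rw [card_filter, card_filter, Fin.sum_univ_add]
    congr 1
    · simp only [Fin.append_left, if_pos hi, sum_const, card_univ, Fintype.card_fin, smul_eq_mul,
        mul_one]
    · simp only [Fin.append_right]
  obtain ⟨F, hF, hval⟩ := exists_hwv_eval_eq_sum_gammaProd hm
    ⟨E + S.C, Fin.append (fun _ : Fin E => m) S.h, ent⟩ hTle hTcount
  refine ⟨F, ?_, fun A => ?_⟩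
  · have hw : (fun j : Fin m => -((univ.filter fun c : Fin (E + S.C) =>
        ((Fin.rev j : Fin m) : ℕ) < Fin.append (fun _ : Fin E => m) S.h c).card : ℤ)) =
        fun j : Fin m => -((E : ℤ) +
          ((univ.filter fun c : Fin S.C => ((Fin.rev j : Fin m) : ℕ) < S.h c).card : ℤ)) := by
      funext j
      rw [hrow _ (Fin.rev j).2, Nat.cast_add]
    rw [← hw]
    exact hF
  · rw [hval A]
    simp only [hsplit]

/-- **Brick B2 of the `IK2020_thm_4_2` edge — the highest-weight vector of a lifted tableau.** Let
`S` be a tableau over `Fin m` whose row `r` has length `λ_r` (`λ ⊢ dD` with at most `m` parts;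
`λ_r = lam.sortedParts.getD r 0 = Weight.ofPartition m λ r`), and let `(L, R)` be a lifting pair as
in `IK2020_thm_13_1` (`E` left columns of height `m`, right part of the shape of `S`, every label
`u < δ` occurring exactly `D` times). Then there is `F ∈ HWV_{(λ + (m × E))^*}(ℂ[Sym^D ℂ^m])`
(tree: `highestWeightSpace (coordRep (Fin m) ℂ D) (Weight.dualOfPartition m (addRect λ m E _))`)
with, for every matrix `A` and `A' = (A_{rev a, b})`,
`F(A · p) = (D!)^δ · ∑_{φ : Fin δ → Fin m} γ(A' (φL)) · γ(A' (φR))` — IK §13, TeX L1185–1197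
("the function corresponding to `T_{ϱ,i}`" is a highest weight vector of weight
`(λ + (m × e_ϱ D))^*` by Thm. 11.1, and "`γ(g M_{m,d} T_{ϱ,i}) = ∑_{φ ∈ ℳ_{m,d}} γ(g φT_{ϱ,i})`").
[cite: IkenmeyerKandasamy2019, Thm. 4.2 (proof, §13) and Thm. 11.1] -/
theorem exists_hwv_liftedTableau {m D d E δ : ℕ} (hm : 0 < m)
    (lam : Nat.Partition (d * D)) (hlam : lam.parts.card ≤ m)
    (S : ColTableau (Fin m)) (hS : ∀ c, S.h c ≤ m)
    (hshape : ∀ r : Fin m,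
      (univ.filter fun c : Fin S.C => (r : ℕ) < S.h c).card = lam.sortedParts.getD r 0)
    (L : Fin E → Fin m → Fin δ) (R : (c : Fin S.C) → Fin (S.h c) → Fin δ)
    (hcount : ∀ u, (rectTableau L).count u + (ColTableau.mk S.C S.h R).count u = D) :
    ∃ F ∈ highestWeightSpace (coordRep (Fin m) ℂ D)
        (Weight.dualOfPartition m (addRect lam m E hlam)),
      ∀ A : Matrix (Fin m) (Fin m) ℂ,
        aeval (formCoeff D (linSubst (Fin m) ℂ A (psum (Fin m) ℂ D))) F =
          (D.factorial : ℂ) ^ δ * ∑ φ : Fin δ → Fin m,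
            gammaProd ℂ (fun a b => A (Fin.rev a) b) (fun _ : Fin E => m) (fun _ => le_rfl)
                (fun c r => φ (L c r)) *
              gammaProd ℂ (fun a b => A (Fin.rev a) b) S.h hS (fun c r => φ (R c r)) := by
  obtain ⟨F, hF, hval⟩ := exists_hwv_eval_eq_sum_gammaProd_pair hm S hS L R hcount
  refine ⟨F, ?_, hval⟩
  have hw : Weight.dualOfPartition m (addRect lam m E hlam) =
      fun j : Fin m => -((E : ℤ) +
        ((univ.filter fun c : Fin S.C => ((Fin.rev j : Fin m) : ℕ) < S.h c).card : ℤ)) := by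
    funext j
    change -(Weight.ofPartition m (addRect lam m E hlam) (Fin.rev j)) = _
    rw [ofPartition_addRect]
    dsimp only
    rw [Weight.ofPartition_apply, ← hshape (Fin.rev j)]
    ring
  rw [hw]
  exact hF

/-- The same with the point written through the reversed matrix: for every `A`,
`F(A'' · p) = (D!)^δ ∑_φ γ(A (φL)) γ(A (φR))` where `A'' = (A_{rev a, b})` (so that the `γ`-side is
evaluated at `A` itself; `rev ∘ rev = id`). [cite: IkenmeyerKandasamy2019, Thm. 4.2 (proof, §13)] -/
theorem exists_hwv_liftedTableau' {m D d E δ : ℕ} (hm : 0 < m)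
    (lam : Nat.Partition (d * D)) (hlam : lam.parts.card ≤ m)
    (S : ColTableau (Fin m)) (hS : ∀ c, S.h c ≤ m)
    (hshape : ∀ r : Fin m,
      (univ.filter fun c : Fin S.C => (r : ℕ) < S.h c).card = lam.sortedParts.getD r 0)
    (L : Fin E → Fin m → Fin δ) (R : (c : Fin S.C) → Fin (S.h c) → Fin δ)
    (hcount : ∀ u, (rectTableau L).count u + (ColTableau.mk S.C S.h R).count u = D) :
    ∃ F ∈ highestWeightSpace (coordRep (Fin m) ℂ D)
        (Weight.dualOfPartition m (addRect lam m E hlam)),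
      ∀ A : Matrix (Fin m) (Fin m) ℂ,
        aeval (formCoeff D (linSubst (Fin m) ℂ (Matrix.of fun a b => A (Fin.rev a) b)
          (psum (Fin m) ℂ D))) F =
          (D.factorial : ℂ) ^ δ * ∑ φ : Fin δ → Fin m,
            gammaProd ℂ A (fun _ : Fin E => m) (fun _ => le_rfl) (fun c r => φ (L c r)) *
              gammaProd ℂ A S.h hS (fun c r => φ (R c r)) := by
  obtain ⟨F, hF, hval⟩ := exists_hwv_liftedTableau hm lam hlam S hS hshape L R hcount
  refine ⟨F, hF, fun A => ?_⟩
  have hA : (fun a b => (Matrix.of fun a b => A (Fin.rev a) b) (Fin.rev a) b) = A := by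
    funext a b
    simp only [Matrix.of_apply, Fin.rev_rev]
  rw [hval, hA]

/-! ### §4 `SL_m`-ready form: rescaling the reversed matrix back into `SL_m`

For the assembly of Thm. 4.2 the `γ`-side must be evaluated at a matrix of determinant `1` (Cor. 8.4
as typed, `IK2020_cor_8_4_sl`; brick B1 `stab_card_mul_sum_gammaProd_lift_eq` has `g.det = 1`), while
`F(s · p)` sees the row-reversed matrix `w₀ s` of determinant `sign(w₀) det s = ± det s`. Since `γ` of
the lifted tableau is homogeneous in the matrix (`gammaProd_smul`), `w₀ s = ζ · (ζ⁻¹ w₀ s)` with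
`ζ^m = sign(w₀)` moves the `γ`-side to `β(s) := ζ⁻¹ w₀ s ∈ SL_m`, `β : SL_m ≃ SL_m`, at the cost of a
nonzero constant: `F(s · p) = c · ∑_φ γ(β s, φL) γ(β s, φR)` (TeX L1153–1154: "homogeneous of the same
degree", L1192: "for `g ∈ SL_m`"). -/

/-- **`γ` is homogeneous in the matrix**: `γ((ζ g) T) = ζ^{|T|} γ(g T)`, `|T| = ∑_c h_c` the number of
boxes (each column determinant of height `j` is homogeneous of degree `j`; eq. (8.2)).
[cite: IkenmeyerKandasamy2019, Lemma 8.1 eq. (8.2)] -/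
theorem gammaProd_smul {k : Type*} [CommRing k] {m C : ℕ} (ζ : k) (g : Matrix (Fin m) (Fin m) k)
    (h : Fin C → ℕ) (hh : ∀ c, h c ≤ m) (T : (c : Fin C) → Fin (h c) → Fin m) :
    gammaProd k (ζ • g) h hh T = ζ ^ (∑ c, h c) * gammaProd k g h hh T := by
  unfold gammaProd
  rw [← prod_pow_eq_pow_sum, ← prod_mul_distrib]
  refine prod_congr rfl fun c _ => ?_
  unfold colTopDet
  have hM : (Matrix.of fun i r : Fin (h c) => (ζ • g) (Fin.castLE (hh c) i) (T c r)) =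
      ζ • Matrix.of fun i r : Fin (h c) => g (Fin.castLE (hh c) i) (T c r) := by
    ext i r
    simp only [Matrix.of_apply, Matrix.smul_apply, smul_eq_mul]
  rw [hM, Matrix.det_smul, Fintype.card_fin]

/-- There is `ζ ∈ ℂ` with `ζ^m = sign(w₀)`, `w₀ = ` the row reversal of `Fin m` (`ℂ` is algebraically
closed; `m ≥ 1`). [folklore] -/
private theorem exists_root_sign_rev_aux {m : ℕ} (hm : 0 < m) :
    ∃ ζ : ℂ, ζ ^ m = ((Equiv.Perm.sign (@Fin.revPerm m) : ℤ) : ℂ) :=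
  IsAlgClosed.exists_pow_nat_eq _ hm

/-- **A root `ζ` of `ζ^m = sign(w₀)`** for the row reversal `w₀` of `Fin m` (`m ≥ 1`): the scalar that
moves `w₀ · SL_m` back into `SL_m` (IK §13, TeX L1153–1154, homogeneity `GL_m p` versus `SL_m p`).
[cite: IkenmeyerKandasamy2019, Thm. 4.2 (proof, §13)] -/
theorem exists_root_sign_rev {m : ℕ} (hm : 0 < m) :
    ∃ ζ : ℂ, ζ ^ m = ((Equiv.Perm.sign (@Fin.revPerm m) : ℤ) : ℂ) :=
  exists_root_sign_rev_aux hm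

/-- The sign of a permutation, cast to `ℂ`, squares to `1`. [folklore] -/
private theorem sign_cast_mul_self {m : ℕ} (σ : Equiv.Perm (Fin m)) :
    ((Equiv.Perm.sign σ : ℤ) : ℂ) * ((Equiv.Perm.sign σ : ℤ) : ℂ) = 1 := by
  rcases Int.units_eq_one_or (Equiv.Perm.sign σ) with h | h <;> simp [h]

/-- **The rescaled reversal `β(s) = ζ⁻¹ w₀ s` is a bijection of `SL_m`** (for `ζ^m = sign(w₀)`):
`det(ζ⁻¹ w₀ s) = ζ^{-m} sign(w₀) det s = det s`, with inverse `t ↦ w₀ (ζ t)`.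
[cite: IkenmeyerKandasamy2019, Thm. 4.2 (proof, §13)] -/
theorem exists_slEquiv_revScale {m : ℕ} (hm : 0 < m) (ζ : ℂ)
    (hζ : ζ ^ m = ((Equiv.Perm.sign (@Fin.revPerm m) : ℤ) : ℂ)) :
    ∃ β : Matrix.SpecialLinearGroup (Fin m) ℂ ≃ Matrix.SpecialLinearGroup (Fin m) ℂ,
      ∀ s : Matrix.SpecialLinearGroup (Fin m) ℂ,
        ((β s : Matrix.SpecialLinearGroup (Fin m) ℂ) : Matrix (Fin m) (Fin m) ℂ) =
          ζ⁻¹ • Matrix.of fun a b => (s : Matrix (Fin m) (Fin m) ℂ) (Fin.rev a) b := by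
  have hε := sign_cast_mul_self (@Fin.revPerm m)
  have hε0 : ((Equiv.Perm.sign (@Fin.revPerm m) : ℤ) : ℂ) ≠ 0 := by
    intro h; rw [h, mul_zero] at hε; exact zero_ne_one hε
  have hζ0 : ζ ≠ 0 := by
    intro h; rw [h, zero_pow hm.ne'] at hζ; exact hε0 hζ.symm
  have hdet1 : ∀ s : Matrix.SpecialLinearGroup (Fin m) ℂ,
      (ζ⁻¹ • Matrix.of fun a b => (s : Matrix (Fin m) (Fin m) ℂ) (Fin.rev a) b).det = 1 := by
    intro s
    rw [Matrix.det_smul, det_revRows_aux, s.det_coe, mul_one, Fintype.card_fin, inv_pow, hζ,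
      inv_mul_cancel₀ hε0]
  have hdet2 : ∀ t : Matrix.SpecialLinearGroup (Fin m) ℂ,
      (Matrix.of fun a b => (ζ • (t : Matrix (Fin m) (Fin m) ℂ)) (Fin.rev a) b).det = 1 := by
    intro t
    rw [det_revRows_aux, Matrix.det_smul, t.det_coe, mul_one, Fintype.card_fin, hζ, hε]
  refine ⟨{ toFun := fun s => ⟨_, hdet1 s⟩
            invFun := fun t => ⟨_, hdet2 t⟩
            left_inv := fun s => ?_
            right_inv := fun t => ?_ }, fun s => rfl⟩
  · apply Subtype.ext
    ext a b
    simp only [Matrix.of_apply, Matrix.smul_apply, smul_eq_mul, Fin.rev_rev,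
      mul_inv_cancel_left₀ hζ0]
  · apply Subtype.ext
    ext a b
    simp only [Matrix.of_apply, Matrix.smul_apply, smul_eq_mul, Fin.rev_rev,
      inv_mul_cancel_left₀ hζ0]

/-- **Transfer of linear independence along a surjection of the domain**: if the functions
`u_i : X → K` are linearly independent and `β : Y → X` is onto, then so are the `u_i ∘ β` (used with
`β : SL_m ≃ SL_m` of `exists_slEquiv_revScale` on the orbit functions of `IK2020_thm_9_1_orbitFunctions`).
[folklore] -/
private theorem linearIndependent_comp_right_of_surjective_aux {K ι X Y : Type*} [Field K]
    {u : ι → X → K} (hu : LinearIndependent K u) (β : Y → X) (hβ : Function.Surjective β) :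
    LinearIndependent K fun i (y : Y) => u i (β y) :=
  hu.map' (LinearMap.funLeft K K β)
    (LinearMap.ker_eq_bot_of_injective (LinearMap.funLeft_injective_of_surjective K K β hβ))

/-- **Transfer of linear independence along a surjection of the domain** (for the assembly: the
orbit functions `f_j` of `IK2020_thm_9_1_orbitFunctions`, independent on `SL_m`, stay independent after
composing with the bijection `β` of `exists_slEquiv_revScale`). [cite: IkenmeyerKandasamy2019, Thm. 4.2 (proof, §13)] -/
theorem linearIndependent_comp_right_of_surjective {K ι X Y : Type*} [Field K]
    {u : ι → X → K} (hu : LinearIndependent K u) (β : Y → X) (hβ : Function.Surjective β) :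
    LinearIndependent K fun i (y : Y) => u i (β y) :=
  linearIndependent_comp_right_of_surjective_aux hu β hβ

/-- **B2, `SL_m`-ready form.** With the data of `exists_hwv_liftedTableau` and any `ζ ≠ 0`: there are
`F ∈ HWV_{(λ + (m × E))^*}(ℂ[Sym^D ℂ^m])` and a constant `c ≠ 0` such that for EVERY matrix `s`,
`F(s · p) = c · ∑_{φ : Fin δ → Fin m} γ(ζ⁻¹ w₀ s, φL) · γ(ζ⁻¹ w₀ s, φR)`, `w₀ s = (s_{rev a, b})`. For
`ζ^m = sign(w₀)` (`exists_root_sign_rev`) and `s ∈ SL_m` the matrix `ζ⁻¹ w₀ s = β(s)` lies in `SL_m`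
(`exists_slEquiv_revScale`), so that B1 (`stab_card_mul_sum_gammaProd_lift_eq`, `det = 1`) applies
at `β(s)` and `IK2020_thm_9_1_orbitFunctions` is used through `β`. (`c = (D!)^δ ζ^{mE + |shape S|}`.)
[cite: IkenmeyerKandasamy2019, Thm. 4.2 (proof, §13) and Thm. 11.1] -/
theorem exists_hwv_liftedTableau_revScale {m D d E δ : ℕ} (hm : 0 < m) (ζ : ℂ) (hζ0 : ζ ≠ 0)
    (lam : Nat.Partition (d * D)) (hlam : lam.parts.card ≤ m)
    (S : ColTableau (Fin m)) (hS : ∀ c, S.h c ≤ m)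
    (hshape : ∀ r : Fin m,
      (univ.filter fun c : Fin S.C => (r : ℕ) < S.h c).card = lam.sortedParts.getD r 0)
    (L : Fin E → Fin m → Fin δ) (R : (c : Fin S.C) → Fin (S.h c) → Fin δ)
    (hcount : ∀ u, (rectTableau L).count u + (ColTableau.mk S.C S.h R).count u = D) :
    ∃ F ∈ highestWeightSpace (coordRep (Fin m) ℂ D)
        (Weight.dualOfPartition m (addRect lam m E hlam)),
      ∃ c : ℂ, c ≠ 0 ∧ ∀ s : Matrix (Fin m) (Fin m) ℂ,
        aeval (formCoeff D (linSubst (Fin m) ℂ s (psum (Fin m) ℂ D))) F =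
          c * ∑ φ : Fin δ → Fin m,
            gammaProd ℂ (ζ⁻¹ • Matrix.of fun a b => s (Fin.rev a) b) (fun _ : Fin E => m)
                (fun _ => le_rfl) (fun c r => φ (L c r)) *
              gammaProd ℂ (ζ⁻¹ • Matrix.of fun a b => s (Fin.rev a) b) S.h hS
                (fun c r => φ (R c r)) := by
  obtain ⟨F, hF, hval⟩ := exists_hwv_liftedTableau hm lam hlam S hS hshape L R hcount
  refine ⟨F, hF, (D.factorial : ℂ) ^ δ * (ζ ^ (∑ _c : Fin E, m) * ζ ^ (∑ c, S.h c)), ?_, fun s => ?_⟩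
  · exact mul_ne_zero (pow_ne_zero _ (Nat.cast_ne_zero.mpr (Nat.factorial_ne_zero D)))
      (mul_ne_zero (pow_ne_zero _ hζ0) (pow_ne_zero _ hζ0))
  · rw [hval s]
    have hs : (fun a b => s (Fin.rev a) b) =
        ζ • (ζ⁻¹ • Matrix.of fun a b => s (Fin.rev a) b) := by
      rw [smul_smul, mul_inv_cancel₀ hζ0, one_smul]
      rfl
    conv_lhs => rw [hs]
    simp only [gammaProd_smul, mul_assoc, Finset.mul_sum]
    refine sum_congr rfl fun φ _ => ?_
    ring

end IK2020

end Literature.Computability.AlgebraicComplexity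

end
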